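import Summits.QuantumFields.YangMills.Theorems.AllWindowsColdBoxBoxHighLineRestrictionSetMoments

/-!
# U5 ε₂-glue (G3a): slot calculus over `μ_{D′}` for a GENERAL measurable set `D′` — norm transfer at `t ≥ 0`, linearity and parity at `t = 0`

Free-hands helper of the κ-lineage (ym-line-fcl-p3 g27) for Steps D–E of the NEXT rung U5 (`stub_landauThirdOrder`, LINE-20, ⟨stmt-QuantumFields-24336⟩),
planner ym-idea-2 g18 GO 2026-08-29T23:39:47Z («general measurable D′; symmetry only in the parity lemmas; sup-type hypotheses as `∀ a ∈ D′, |G a| ≤ B`»).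
The cell's `μ_D` letters (✓13n `Tilt.tiltExp_muD_le_gaussAvg`, ✓`TiltParity`, ✓`TiltCum3Split`) are specific to `D = smallField H s`; ASSEMBLY-U5 §3 runs Steps D–E on
the CUT small field `D′ = smallField s ∩ {|βV₃| ≤ 1}`.  Over ✓`…RestrictionSetMoments` (`μ_D := (volume.restrict D).withDensity (ofReal ∘ gaussWeight β H)`,
`1_D = D.indicator (fun _ => 1)`, `E₀ = gaussAvg β H`) this file re-letters, for an ARBITRARY measurable `D`:

* §1 NORM TRANSFER at `t ≥ 0` (13n-set): `integrable_muSet_of`, ★`tiltExp_muSet_le_gaussAvg` (`E_t^{μ_D}[G] ≤ e^{2tB}·E₀[1_D G]/E₀[1_D]` for `0 ≤ G`,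
  `|U| ≤ B` on `D`), ★`tiltExp_muSet_ge_gaussAvg` (lower), and at `t = 0` `tiltExp_muSet_zero_le_two_mul_gaussAvg` (`E_0^{μ_D}[G] ≤ 2·E₀[G]` when `E₀[1_D] ≥ 1/2`)
  — the moment inputs of w5 g24's κ₅ sizes on the cut set;
* §2 LINEARITY at `t = 0` for observables measurable and bounded on `D`: `integrable_indicator_mul_of_bdd`, `tiltExp_muSet_zero_add/sub/const/const_mul/neg`,
  `abs_tiltExp_muSet_zero_le` (`|E_0 G| ≤ B`);
* §3 PARITY for a SYMMETRIC `D` (`∀ a, −a ∈ D ↔ a ∈ D`): `indicator_one_neg`, `gaussAvg_indicator_mul_eq_zero_of_odd`, `tiltExp_muSet_zero_eq_zero_of_odd`,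
  `…_mul_eq_zero_of_even_odd/odd_even`, and ★`tiltCum3_muSet_zero_parity_split` (LEAD g77's ✓`tiltCum3_muD_zero_parity_split` on a general symmetric `D`:
  `κ₃,₀(E₁+O₁, E₂+O₂; U_e+U_o) = E_0[Ẽ₁Ẽ₂Ũ_e] + E_0[Ẽ₁·O₂·U_o] + E_0[O₁·Ẽ₂·U_o] + E_0[O₁·O₂·Ũ_e]`).

No definitions; standard axioms.  HONEST LABEL: helper-grade glue for U5 prep; U5, ⟨24004⟩, ⟨24336⟩ remain OPEN; route AllWindowsColdBox is DRAFT;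
no crux, rung or summit is proved; the Yang–Mills mass gap is NOT proved by this file; no summit is proved by a line.
-/

set_option autoImplicit false

noncomputable section

open MeasureTheory Set

namespace Summit.QuantumFields.YangMills.Theorems.AllWindowsColdBoxBoxHighLine

namespace GaussRestrict

variable {H : ℕ} {β : ℝ}

/-! ## §1 Norm transfer at `t ≥ 0` over `μ_D` -/

/-- `G` is `μ_D`-integrable once `G·gaussWeight` is Lebesgue-integrable. -/
theorem integrable_muSet_of (hβ : 0 < β) (D : Set (LandauFree H → E3)) {G : (LandauFree H → E3) → ℝ}
    (hG : Integrable fun a => G a * gaussWeight β H a) :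
    Integrable G ((((volume : Measure (LandauFree H → E3)).restrict D).withDensity fun a => ENNReal.ofReal (gaussWeight β H a))) := by
  have hw : AEMeasurable (fun a : LandauFree H → E3 => ENNReal.ofReal (gaussWeight β H a)) (volume.restrict D) :=
    (EdgeChartGaussian.aestronglyMeasurable_gaussWeight H hβ).aemeasurable.ennreal_ofReal.restrict
  refine (integrable_withDensity_iff_integrable_smul₀' hw (Filter.Eventually.of_forall fun _ => ENNReal.ofReal_lt_top)).2 ?_
  refine (hG.restrict (s := D)).congr (Filter.Eventually.of_forall fun a => ?_)
  show G a * gaussWeight β H a = (ENNReal.ofReal (gaussWeight β H a)).toReal • G a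
  rw [ENNReal.toReal_ofReal (EdgeChartGaussian.gaussWeight_pos β H a).le, smul_eq_mul, mul_comm]

/-- ★ **NORM TRANSFER over `μ_D`, upper** (13n on a general measurable `D`): for `0 ≤ G` with `G·gaussWeight` integrable, `U` measurable with `|U| ≤ B`
on `D`, `0 ≤ t` and `0 < ∫ 1_D·gaussWeight`:  `E_t^{μ_D}[G] ≤ e^{2tB} · E₀[1_D·G]/E₀[1_D]`. -/
theorem tiltExp_muSet_le_gaussAvg (hβ : 0 < β) {D : Set (LandauFree H → E3)} (hDm : MeasurableSet D)
    (hD : 0 < ∫ a, D.indicator (fun _ => (1 : ℝ)) a * gaussWeight β H a) {U G : (LandauFree H → E3) → ℝ} {B t : ℝ} (ht : 0 ≤ t)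
    (hU : Measurable U) (hUb : ∀ a ∈ D, |U a| ≤ B) (hG0 : 0 ≤ G) (hG : Integrable fun a => G a * gaussWeight β H a) :
    Tilt.tiltExp ((((volume : Measure (LandauFree H → E3)).restrict D).withDensity fun a => ENNReal.ofReal (gaussWeight β H a))) U t G ≤
      Real.exp (2 * t * B) * (gaussAvg β H (fun a => D.indicator (fun _ => (1 : ℝ)) a * G a) / gaussAvg β H (D.indicator (fun _ => (1 : ℝ)))) := by
  haveI := isFiniteMeasure_muSet hβ D
  haveI := neZero_muSet hβ hDm hD
  have hZ := EdgeChartGaussian.integral_gaussWeight_pos H hβ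
  have hUb' : ∀ᵐ a ∂((((volume : Measure (LandauFree H → E3)).restrict D).withDensity fun a => ENNReal.ofReal (gaussWeight β H a))), |U a| ≤ B := by
    filter_upwards [ae_muSet_mem β hDm] with a ha using hUb a ha
  have h := Tilt.tiltExp_le_of_nonneg (μ := (((volume : Measure (LandauFree H → E3)).restrict D).withDensity fun a => ENNReal.ofReal (gaussWeight β H a)))
    ht hU.aemeasurable hUb' hG0 (integrable_muSet_of hβ D hG)
  rw [integral_muSet_eq hβ hDm, muSet_univ_toReal hβ hDm] at h
  refine h.trans (le_of_eq ?_)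
  congr 1
  unfold gaussAvg
  rw [div_div_div_cancel_right₀ hZ.ne']
  congr 1
  refine integral_congr_ae (Filter.Eventually.of_forall fun a => ?_)
  ring

/-- ★ **NORM TRANSFER over `μ_D`, lower**: `e^{−2tB} · E₀[1_D·G]/E₀[1_D] ≤ E_t^{μ_D}[G]` (`0 ≤ G` with `G·e^{tU}·gaussWeight` integrable). -/
theorem tiltExp_muSet_ge_gaussAvg (hβ : 0 < β) {D : Set (LandauFree H → E3)} (hDm : MeasurableSet D)
    (hD : 0 < ∫ a, D.indicator (fun _ => (1 : ℝ)) a * gaussWeight β H a) {U G : (LandauFree H → E3) → ℝ} {B t : ℝ} (ht : 0 ≤ t)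
    (hU : Measurable U) (hUb : ∀ a ∈ D, |U a| ≤ B) (hG0 : 0 ≤ G) (hGe : Integrable fun a => G a * Real.exp (t * U a) * gaussWeight β H a) :
    Real.exp (-(2 * t * B)) * (gaussAvg β H (fun a => D.indicator (fun _ => (1 : ℝ)) a * G a) / gaussAvg β H (D.indicator (fun _ => (1 : ℝ)))) ≤
      Tilt.tiltExp ((((volume : Measure (LandauFree H → E3)).restrict D).withDensity fun a => ENNReal.ofReal (gaussWeight β H a))) U t G := by
  haveI := isFiniteMeasure_muSet hβ D
  haveI := neZero_muSet hβ hDm hD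
  have hZ := EdgeChartGaussian.integral_gaussWeight_pos H hβ
  have hUb' : ∀ᵐ a ∂((((volume : Measure (LandauFree H → E3)).restrict D).withDensity fun a => ENNReal.ofReal (gaussWeight β H a))), |U a| ≤ B := by
    filter_upwards [ae_muSet_mem β hDm] with a ha using hUb a ha
  have h := Tilt.tiltExp_ge_of_nonneg (μ := (((volume : Measure (LandauFree H → E3)).restrict D).withDensity fun a => ENNReal.ofReal (gaussWeight β H a)))
    ht hU.aemeasurable hUb' hG0 (integrable_muSet_of hβ D hGe)
  rw [integral_muSet_eq hβ hDm, muSet_univ_toReal hβ hDm] at h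
  refine le_trans (le_of_eq ?_) h
  congr 1
  unfold gaussAvg
  rw [div_div_div_cancel_right₀ hZ.ne']
  congr 1
  refine integral_congr_ae (Filter.Eventually.of_forall fun a => ?_)
  ring

/-- `E₀[1_D·G] ≤ E₀[G]` for `0 ≤ G` with `G·gaussWeight` integrable. -/
theorem gaussAvg_indicator_mul_le (hβ : 0 < β) (D : Set (LandauFree H → E3)) {G : (LandauFree H → E3) → ℝ} (hG0 : 0 ≤ G)
    (hG : Integrable fun a => G a * gaussWeight β H a) :
    gaussAvg β H (fun a => D.indicator (fun _ => (1 : ℝ)) a * G a) ≤ gaussAvg β H G := by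
  refine EdgeChartGaussian.gaussAvg_mono_of_nonneg H hβ (fun a => mul_nonneg (indicator_one_nonneg_le_one D a).1 (hG0 a)) (fun a => ?_) hG
  calc D.indicator (fun _ => (1 : ℝ)) a * G a ≤ 1 * G a := mul_le_mul_of_nonneg_right (indicator_one_nonneg_le_one D a).2 (hG0 a)
    _ = G a := one_mul _

/-- ★ **Moments at `t = 0` over `μ_D` are at most twice the Gaussian ones**: `E₀[1 − 1_D] ≤ τ ≤ 1/2`, `0 ≤ G`, `G·gaussWeight` integrable ⇒
`E_0^{μ_D}[G] ≤ 2·E₀[G]` (any tilt letter `U`). -/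
theorem tiltExp_muSet_zero_le_two_mul_gaussAvg (hβ : 0 < β) {D : Set (LandauFree H → E3)} (hDm : MeasurableSet D) {τ : ℝ}
    (hτ : gaussAvg β H (fun a => 1 - D.indicator (fun _ => (1 : ℝ)) a) ≤ τ) (hτ2 : τ ≤ 1 / 2) (U : (LandauFree H → E3) → ℝ)
    {G : (LandauFree H → E3) → ℝ} (hG0 : 0 ≤ G) (hG : Integrable fun a => G a * gaussWeight β H a) :
    Tilt.tiltExp ((((volume : Measure (LandauFree H → E3)).restrict D).withDensity fun a => ENNReal.ofReal (gaussWeight β H a))) U 0 G ≤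
      2 * gaussAvg β H G := by
  rw [tiltExp_muSet_zero_eq hβ hDm]
  have hp := half_le_gaussAvg_indicator hβ hDm hτ hτ2
  have hp0 : 0 < gaussAvg β H (D.indicator (fun _ => (1 : ℝ))) := by linarith
  have hnum := gaussAvg_indicator_mul_le hβ D hG0 hG
  have hG' : 0 ≤ gaussAvg β H G := EdgeChartGaussian.gaussAvg_nonneg H hβ hG0
  rw [div_le_iff₀ hp0]
  nlinarith

/-! ## §2 Linearity of `E_0` over `μ_D` for observables bounded on `D` -/

/-- `1_D·P·gaussWeight` is integrable for `P` measurable and bounded on `D`. -/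
theorem integrable_indicator_mul_of_bdd (hβ : 0 < β) {D : Set (LandauFree H → E3)} (hDm : MeasurableSet D) {P : (LandauFree H → E3) → ℝ} {B : ℝ}
    (hPm : Measurable P) (hB : 0 ≤ B) (hP : ∀ a ∈ D, |P a| ≤ B) :
    Integrable fun a : LandauFree H → E3 => D.indicator (fun _ => (1 : ℝ)) a * P a * gaussWeight β H a :=
  Tilt.integrable_bdd_mul_gaussWeight H hβ ((measurable_const.indicator hDm).mul hPm) (abs_indicator_one_mul_le hB hP)

/-- `E_0[F + G] = E_0[F] + E_0[G]` over `μ_D` for measurable `F`, `G` bounded on `D`. -/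
theorem tiltExp_muSet_zero_add (hβ : 0 < β) {D : Set (LandauFree H → E3)} (hDm : MeasurableSet D) (U : (LandauFree H → E3) → ℝ)
    {F G : (LandauFree H → E3) → ℝ} {B : ℝ} (hB : 0 ≤ B) (hFm : Measurable F) (hGm : Measurable G) (hF : ∀ a ∈ D, |F a| ≤ B) (hG : ∀ a ∈ D, |G a| ≤ B) :
    Tilt.tiltExp ((((volume : Measure (LandauFree H → E3)).restrict D).withDensity fun a => ENNReal.ofReal (gaussWeight β H a))) U 0 (fun a => F a + G a) =
      Tilt.tiltExp ((((volume : Measure (LandauFree H → E3)).restrict D).withDensity fun a => ENNReal.ofReal (gaussWeight β H a))) U 0 F +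
        Tilt.tiltExp ((((volume : Measure (LandauFree H → E3)).restrict D).withDensity fun a => ENNReal.ofReal (gaussWeight β H a))) U 0 G := by
  rw [tiltExp_muSet_zero_eq hβ hDm, tiltExp_muSet_zero_eq hβ hDm, tiltExp_muSet_zero_eq hβ hDm, ← add_div]
  congr 1
  rw [← EdgeChartGaussian.gaussAvg_add _ _ (integrable_indicator_mul_of_bdd hβ hDm hFm hB hF) (integrable_indicator_mul_of_bdd hβ hDm hGm hB hG)]
  exact congrArg _ (funext fun a => by ring)

/-- `E_0[F − G] = E_0[F] − E_0[G]` over `μ_D`. -/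
theorem tiltExp_muSet_zero_sub (hβ : 0 < β) {D : Set (LandauFree H → E3)} (hDm : MeasurableSet D) (U : (LandauFree H → E3) → ℝ)
    {F G : (LandauFree H → E3) → ℝ} {B : ℝ} (hB : 0 ≤ B) (hFm : Measurable F) (hGm : Measurable G) (hF : ∀ a ∈ D, |F a| ≤ B) (hG : ∀ a ∈ D, |G a| ≤ B) :
    Tilt.tiltExp ((((volume : Measure (LandauFree H → E3)).restrict D).withDensity fun a => ENNReal.ofReal (gaussWeight β H a))) U 0 (fun a => F a - G a) =
      Tilt.tiltExp ((((volume : Measure (LandauFree H → E3)).restrict D).withDensity fun a => ENNReal.ofReal (gaussWeight β H a))) U 0 F -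
        Tilt.tiltExp ((((volume : Measure (LandauFree H → E3)).restrict D).withDensity fun a => ENNReal.ofReal (gaussWeight β H a))) U 0 G := by
  have hGn : ∀ a ∈ D, |(-G a)| ≤ B := fun a ha => by rw [abs_neg]; exact hG a ha
  have hGm' : Measurable fun a => -G a := hGm.neg
  have h := tiltExp_muSet_zero_add hβ hDm U hB hFm hGm' hF hGn
  have hneg : Tilt.tiltExp ((((volume : Measure (LandauFree H → E3)).restrict D).withDensity fun a => ENNReal.ofReal (gaussWeight β H a))) U 0
      (fun a => -G a) = -Tilt.tiltExp ((((volume : Measure (LandauFree H → E3)).restrict D).withDensity fun a => ENNReal.ofReal (gaussWeight β H a))) U 0 G := by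
    rw [show (fun a => -G a) = fun a => (-1 : ℝ) * G a from funext fun a => by ring, Tilt.tiltExp_const_mul]; ring
  simp only [sub_eq_add_neg]
  rw [h, hneg]

/-- `E_0[c] = c` over `μ_D` (positive Gaussian mass of `D`). -/
theorem tiltExp_muSet_zero_const (hβ : 0 < β) {D : Set (LandauFree H → E3)} (hDm : MeasurableSet D) (U : (LandauFree H → E3) → ℝ)
    (hD : 0 < ∫ a, D.indicator (fun _ => (1 : ℝ)) a * gaussWeight β H a) (c : ℝ) :
    Tilt.tiltExp ((((volume : Measure (LandauFree H → E3)).restrict D).withDensity fun a => ENNReal.ofReal (gaussWeight β H a))) U 0 (fun _ => c) = c := by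
  rw [tiltExp_muSet_zero_eq hβ hDm]
  have hZ := EdgeChartGaussian.integral_gaussWeight_pos H hβ
  have hne : gaussAvg β H (D.indicator (fun _ => (1 : ℝ))) ≠ 0 := by
    unfold gaussAvg; exact (div_pos hD hZ).ne'
  have h : gaussAvg β H (fun a => D.indicator (fun _ => (1 : ℝ)) a * c) = c * gaussAvg β H (D.indicator (fun _ => (1 : ℝ))) := by
    rw [← EdgeChartGaussian.gaussAvg_const_mul]
    exact congrArg _ (funext fun a => by ring)
  rw [h, mul_div_assoc, div_self hne, mul_one]

/-- `E_0[c·F] = c·E_0[F]` over `μ_D` (any `F`). -/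
theorem tiltExp_muSet_zero_const_mul (β : ℝ) (D : Set (LandauFree H → E3)) (U : (LandauFree H → E3) → ℝ) (c : ℝ) (F : (LandauFree H → E3) → ℝ) :
    Tilt.tiltExp ((((volume : Measure (LandauFree H → E3)).restrict D).withDensity fun a => ENNReal.ofReal (gaussWeight β H a))) U 0 (fun a => c * F a) =
      c * Tilt.tiltExp ((((volume : Measure (LandauFree H → E3)).restrict D).withDensity fun a => ENNReal.ofReal (gaussWeight β H a))) U 0 F :=
  Tilt.tiltExp_const_mul U 0 c F

/-- `|E_0[F]| ≤ B` over `μ_D` for `F` measurable with `|F| ≤ B` on `D` (positive Gaussian mass of `D`). -/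
theorem abs_tiltExp_muSet_zero_le (hβ : 0 < β) {D : Set (LandauFree H → E3)} (hDm : MeasurableSet D)
    (hD : 0 < ∫ a, D.indicator (fun _ => (1 : ℝ)) a * gaussWeight β H a) (U : (LandauFree H → E3) → ℝ) {F : (LandauFree H → E3) → ℝ} {B : ℝ}
    (hB : 0 ≤ B) (hF : ∀ a ∈ D, |F a| ≤ B) :
    |Tilt.tiltExp ((((volume : Measure (LandauFree H → E3)).restrict D).withDensity fun a => ENNReal.ofReal (gaussWeight β H a))) U 0 F| ≤ B := by
  rw [tiltExp_muSet_zero_eq hβ hDm]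
  have hZ := EdgeChartGaussian.integral_gaussWeight_pos H hβ
  have hpos : 0 < gaussAvg β H (D.indicator (fun _ => (1 : ℝ))) := by unfold gaussAvg; exact div_pos hD hZ
  rw [abs_div, abs_of_pos hpos, div_le_iff₀ hpos]
  have h1 : |gaussAvg β H (fun a => D.indicator (fun _ => (1 : ℝ)) a * F a)| ≤ gaussAvg β H (fun a => |D.indicator (fun _ => (1 : ℝ)) a * F a|) := by
    unfold gaussAvg
    rw [abs_div, abs_of_pos hZ]
    refine div_le_div_of_nonneg_right ?_ hZ.le
    refine (abs_integral_le_integral_abs).trans (le_of_eq (integral_congr_ae (Filter.Eventually.of_forall fun a => ?_)))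
    simp only [abs_mul, abs_of_pos (EdgeChartGaussian.gaussWeight_pos β H a)]
  have h2 : gaussAvg β H (fun a => |D.indicator (fun _ => (1 : ℝ)) a * F a|) ≤ gaussAvg β H (fun a => B * D.indicator (fun _ => (1 : ℝ)) a) := by
    have hIb : Integrable fun a : LandauFree H → E3 => B * D.indicator (fun _ => (1 : ℝ)) a * gaussWeight β H a := by
      refine Tilt.integrable_bdd_mul_gaussWeight H hβ ((measurable_const.indicator hDm).const_mul B) (C := B) fun a => ?_
      by_cases ha : a ∈ D
      · rw [Set.indicator_of_mem ha, mul_one, abs_of_nonneg hB]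
      · rw [Set.indicator_of_notMem ha, mul_zero, abs_zero]; exact hB
    refine EdgeChartGaussian.gaussAvg_mono_of_nonneg H hβ (fun a => abs_nonneg _) (fun a => ?_) hIb
    by_cases ha : a ∈ D
    · rw [Set.indicator_of_mem ha, one_mul, mul_one]; exact hF a ha
    · rw [Set.indicator_of_notMem ha, zero_mul, abs_zero, mul_zero]
  rw [EdgeChartGaussian.gaussAvg_const_mul] at h2
  exact h1.trans h2

/-! ## §3 Parity over `μ_D` for a SYMMETRIC `D` -/

/-- The indicator of a symmetric set is even. -/
theorem indicator_one_neg {D : Set (LandauFree H → E3)} (hsym : ∀ a, -a ∈ D ↔ a ∈ D) (a : LandauFree H → E3) :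
    D.indicator (fun _ => (1 : ℝ)) (-a) = D.indicator (fun _ => (1 : ℝ)) a := by
  by_cases ha : a ∈ D
  · rw [Set.indicator_of_mem ha, Set.indicator_of_mem ((hsym a).2 ha)]
  · rw [Set.indicator_of_notMem ha, Set.indicator_of_notMem (fun h => ha ((hsym a).1 h))]

/-- `E₀[1_D·F] = 0` for a symmetric `D` and an odd `F`. -/
theorem gaussAvg_indicator_mul_eq_zero_of_odd (β : ℝ) {D : Set (LandauFree H → E3)} (hsym : ∀ a, -a ∈ D ↔ a ∈ D)
    {F : (LandauFree H → E3) → ℝ} (hF : ∀ a, F (-a) = -F a) : gaussAvg β H (fun a => D.indicator (fun _ => (1 : ℝ)) a * F a) = 0 :=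
  EdgeChartGaussian.gaussAvg_mul_eq_zero_of_even_odd β H (indicator_one_neg hsym) hF

/-- ★ **Parity over `μ_D`**: an odd observable has `E_0 = 0` over a symmetric `D`. -/
theorem tiltExp_muSet_zero_eq_zero_of_odd (hβ : 0 < β) {D : Set (LandauFree H → E3)} (hDm : MeasurableSet D) (hsym : ∀ a, -a ∈ D ↔ a ∈ D)
    (U : (LandauFree H → E3) → ℝ) {G : (LandauFree H → E3) → ℝ} (hG : ∀ a, G (-a) = -G a) :
    Tilt.tiltExp ((((volume : Measure (LandauFree H → E3)).restrict D).withDensity fun a => ENNReal.ofReal (gaussWeight β H a))) U 0 G = 0 := by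
  rw [tiltExp_muSet_zero_eq hβ hDm, gaussAvg_indicator_mul_eq_zero_of_odd β hsym hG, zero_div]

/-- Even × odd ⇒ `E_0 = 0` over a symmetric `D`. -/
theorem tiltExp_muSet_zero_mul_eq_zero_of_even_odd (hβ : 0 < β) {D : Set (LandauFree H → E3)} (hDm : MeasurableSet D)
    (hsym : ∀ a, -a ∈ D ↔ a ∈ D) (U : (LandauFree H → E3) → ℝ) {F G : (LandauFree H → E3) → ℝ} (hF : ∀ a, F (-a) = F a)
    (hG : ∀ a, G (-a) = -G a) :
    Tilt.tiltExp ((((volume : Measure (LandauFree H → E3)).restrict D).withDensity fun a => ENNReal.ofReal (gaussWeight β H a))) U 0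
      (fun a => F a * G a) = 0 :=
  tiltExp_muSet_zero_eq_zero_of_odd hβ hDm hsym U fun a => by rw [hF, hG, mul_neg]

/-- Odd × even ⇒ `E_0 = 0` over a symmetric `D`. -/
theorem tiltExp_muSet_zero_mul_eq_zero_of_odd_even (hβ : 0 < β) {D : Set (LandauFree H → E3)} (hDm : MeasurableSet D)
    (hsym : ∀ a, -a ∈ D ↔ a ∈ D) (U : (LandauFree H → E3) → ℝ) {F G : (LandauFree H → E3) → ℝ} (hF : ∀ a, F (-a) = -F a)
    (hG : ∀ a, G (-a) = G a) :
    Tilt.tiltExp ((((volume : Measure (LandauFree H → E3)).restrict D).withDensity fun a => ENNReal.ofReal (gaussWeight β H a))) U 0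
      (fun a => F a * G a) = 0 :=
  tiltExp_muSet_zero_eq_zero_of_odd hβ hDm hsym U fun a => by rw [hF, hG, neg_mul]

/-- ★ **Parity split of `κ₃,₀` over `μ_D` for a symmetric `D`** (✓`Tilt.tiltCum3_muD_zero_parity_split` re-lettered).  For measurable
`E₁, O₁, E₂, O₂, U_e, U_o` bounded by `B` on `D`, `E₁, E₂, U_e` even and `O₁, O₂, U_o` odd, and `D` symmetric of positive Gaussian mass:
`κ₃,₀(E₁+O₁, E₂+O₂; U_e+U_o) = E_0[Ẽ₁Ẽ₂Ũ_e] + E_0[Ẽ₁·O₂·U_o] + E_0[O₁·Ẽ₂·U_o] + E_0[O₁·O₂·Ũ_e]` (`Ẽᵢ = Eᵢ − E_0[Eᵢ]`, `Ũ_e = U_e − E_0[U_e]`). -/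
theorem tiltCum3_muSet_zero_parity_split (hβ : 0 < β) {D : Set (LandauFree H → E3)} (hDm : MeasurableSet D) (hsym : ∀ a, -a ∈ D ↔ a ∈ D)
    (hD : 0 < ∫ a, D.indicator (fun _ => (1 : ℝ)) a * gaussWeight β H a)
    {E₁ O₁ E₂ O₂ Ue Uo : (LandauFree H → E3) → ℝ} {B : ℝ} (hB : 0 ≤ B)
    (mE₁ : Measurable E₁) (mO₁ : Measurable O₁) (mE₂ : Measurable E₂) (mO₂ : Measurable O₂) (mUe : Measurable Ue) (mUo : Measurable Uo)
    (bE₁ : ∀ a ∈ D, |E₁ a| ≤ B) (bO₁ : ∀ a ∈ D, |O₁ a| ≤ B) (bE₂ : ∀ a ∈ D, |E₂ a| ≤ B)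
    (bO₂ : ∀ a ∈ D, |O₂ a| ≤ B) (bUe : ∀ a ∈ D, |Ue a| ≤ B) (bUo : ∀ a ∈ D, |Uo a| ≤ B)
    (pE₁ : ∀ a, E₁ (-a) = E₁ a) (pO₁ : ∀ a, O₁ (-a) = -O₁ a) (pE₂ : ∀ a, E₂ (-a) = E₂ a) (pO₂ : ∀ a, O₂ (-a) = -O₂ a)
    (pUe : ∀ a, Ue (-a) = Ue a) (pUo : ∀ a, Uo (-a) = -Uo a) :
    let μD : Measure (LandauFree H → E3) := (((volume : Measure (LandauFree H → E3)).restrict D).withDensity fun a => ENNReal.ofReal (gaussWeight β H a))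
    let U : (LandauFree H → E3) → ℝ := fun a => Ue a + Uo a
    Tilt.tiltCum3 μD U 0 (fun a => E₁ a + O₁ a) (fun a => E₂ a + O₂ a) =
      Tilt.tiltExp μD U 0 (fun a => (E₁ a - Tilt.tiltExp μD U 0 E₁) * (E₂ a - Tilt.tiltExp μD U 0 E₂) * (Ue a - Tilt.tiltExp μD U 0 Ue)) +
      Tilt.tiltExp μD U 0 (fun a => (E₁ a - Tilt.tiltExp μD U 0 E₁) * O₂ a * Uo a) +
      Tilt.tiltExp μD U 0 (fun a => O₁ a * (E₂ a - Tilt.tiltExp μD U 0 E₂) * Uo a) +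
      Tilt.tiltExp μD U 0 (fun a => O₁ a * O₂ a * (Ue a - Tilt.tiltExp μD U 0 Ue)) := by
  intro μD U
  -- means: the odd parts have zero mean
  have hO₁ : Tilt.tiltExp μD U 0 O₁ = 0 := tiltExp_muSet_zero_eq_zero_of_odd hβ hDm hsym U pO₁
  have hO₂ : Tilt.tiltExp μD U 0 O₂ = 0 := tiltExp_muSet_zero_eq_zero_of_odd hβ hDm hsym U pO₂
  have hUo : Tilt.tiltExp μD U 0 Uo = 0 := tiltExp_muSet_zero_eq_zero_of_odd hβ hDm hsym U pUo
  have hG₁ : Tilt.tiltExp μD U 0 (fun a => E₁ a + O₁ a) = Tilt.tiltExp μD U 0 E₁ := by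
    rw [show Tilt.tiltExp μD U 0 (fun a => E₁ a + O₁ a) = Tilt.tiltExp μD U 0 E₁ + Tilt.tiltExp μD U 0 O₁ from
      tiltExp_muSet_zero_add hβ hDm U hB mE₁ mO₁ bE₁ bO₁, hO₁, add_zero]
  have hG₂ : Tilt.tiltExp μD U 0 (fun a => E₂ a + O₂ a) = Tilt.tiltExp μD U 0 E₂ := by
    rw [show Tilt.tiltExp μD U 0 (fun a => E₂ a + O₂ a) = Tilt.tiltExp μD U 0 E₂ + Tilt.tiltExp μD U 0 O₂ from
      tiltExp_muSet_zero_add hβ hDm U hB mE₂ mO₂ bE₂ bO₂, hO₂, add_zero]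
  have hU : Tilt.tiltExp μD U 0 U = Tilt.tiltExp μD U 0 Ue := by
    rw [show Tilt.tiltExp μD U 0 U = Tilt.tiltExp μD U 0 Ue + Tilt.tiltExp μD U 0 Uo from
      tiltExp_muSet_zero_add hβ hDm U hB mUe mUo bUe bUo, hUo, add_zero]
  set m₁ := Tilt.tiltExp μD U 0 E₁ with hm₁
  set m₂ := Tilt.tiltExp μD U 0 E₂ with hm₂
  set mu := Tilt.tiltExp μD U 0 Ue with hmu
  -- the means are bounded by B
  have bm₁ : |m₁| ≤ B := abs_tiltExp_muSet_zero_le hβ hDm hD U hB bE₁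
  have bm₂ : |m₂| ≤ B := abs_tiltExp_muSet_zero_le hβ hDm hD U hB bE₂
  have bmu : |mu| ≤ B := abs_tiltExp_muSet_zero_le hβ hDm hD U hB bUe
  -- centred parts: measurable, bounded by 2B on D, even
  have mC₁ : Measurable fun a => E₁ a - m₁ := mE₁.sub measurable_const
  have mC₂ : Measurable fun a => E₂ a - m₂ := mE₂.sub measurable_const
  have mCu : Measurable fun a => Ue a - mu := mUe.sub measurable_const
  have bC₁ : ∀ a ∈ D, |E₁ a - m₁| ≤ 2 * B := fun a ha => by
    have := abs_sub _ _ |>.trans (add_le_add (bE₁ a ha) bm₁); linarith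
  have bC₂ : ∀ a ∈ D, |E₂ a - m₂| ≤ 2 * B := fun a ha => by
    have := abs_sub _ _ |>.trans (add_le_add (bE₂ a ha) bm₂); linarith
  have bCu : ∀ a ∈ D, |Ue a - mu| ≤ 2 * B := fun a ha => by
    have := abs_sub _ _ |>.trans (add_le_add (bUe a ha) bmu); linarith
  have pC₁ : ∀ a, E₁ (-a) - m₁ = E₁ a - m₁ := fun a => by rw [pE₁]
  have pC₂ : ∀ a, E₂ (-a) - m₂ = E₂ a - m₂ := fun a => by rw [pE₂]
  have pCu : ∀ a, Ue (-a) - mu = Ue a - mu := fun a => by rw [pUe]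
  have b2 : ∀ {F : (LandauFree H → E3) → ℝ}, (∀ a ∈ D, |F a| ≤ B) → ∀ a ∈ D, |F a| ≤ 2 * B :=
    fun hF a ha => (hF a ha).trans (by linarith)
  have trip : ∀ {F G K : (LandauFree H → E3) → ℝ}, (∀ a ∈ D, |F a| ≤ 2 * B) → (∀ a ∈ D, |G a| ≤ 2 * B) →
      (∀ a ∈ D, |K a| ≤ 2 * B) → ∀ a ∈ D, |F a * G a * K a| ≤ (2 * B) ^ 3 := by
    intro F G K hF hG hK a ha
    rw [abs_mul, abs_mul]
    have h1 := hF a ha; have h2 := hG a ha; have h3 := hK a ha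
    calc |F a| * |G a| * |K a| ≤ 2 * B * (2 * B) * (2 * B) :=
          mul_le_mul (mul_le_mul h1 h2 (abs_nonneg _) (by linarith)) h3 (abs_nonneg _) (by positivity)
      _ = (2 * B) ^ 3 := by ring
  -- the eight products
  set P1 : (LandauFree H → E3) → ℝ := fun a => (E₁ a - m₁) * (E₂ a - m₂) * (Ue a - mu) with hP1
  set P2 : (LandauFree H → E3) → ℝ := fun a => (E₁ a - m₁) * (E₂ a - m₂) * Uo a with hP2
  set P3 : (LandauFree H → E3) → ℝ := fun a => (E₁ a - m₁) * O₂ a * (Ue a - mu) with hP3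
  set P4 : (LandauFree H → E3) → ℝ := fun a => (E₁ a - m₁) * O₂ a * Uo a with hP4
  set P5 : (LandauFree H → E3) → ℝ := fun a => O₁ a * (E₂ a - m₂) * (Ue a - mu) with hP5
  set P6 : (LandauFree H → E3) → ℝ := fun a => O₁ a * (E₂ a - m₂) * Uo a with hP6
  set P7 : (LandauFree H → E3) → ℝ := fun a => O₁ a * O₂ a * (Ue a - mu) with hP7
  set P8 : (LandauFree H → E3) → ℝ := fun a => O₁ a * O₂ a * Uo a with hP8
  -- the four vanishing terms (odd integrands)
  have v2 : Tilt.tiltExp μD U 0 P2 = 0 := tiltExp_muSet_zero_eq_zero_of_odd hβ hDm hsym U fun a => by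
    simp only [hP2]; rw [pC₁, pC₂, pUo]; ring
  have v3 : Tilt.tiltExp μD U 0 P3 = 0 := tiltExp_muSet_zero_eq_zero_of_odd hβ hDm hsym U fun a => by
    simp only [hP3]; rw [pC₁, pO₂, pCu]; ring
  have v5 : Tilt.tiltExp μD U 0 P5 = 0 := tiltExp_muSet_zero_eq_zero_of_odd hβ hDm hsym U fun a => by
    simp only [hP5]; rw [pO₁, pC₂, pCu]; ring
  have v8 : Tilt.tiltExp μD U 0 P8 = 0 := tiltExp_muSet_zero_eq_zero_of_odd hβ hDm hsym U fun a => by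
    simp only [hP8]; rw [pO₁, pO₂, pUo]; ring
  have hB8 : 0 ≤ (2 * B) ^ 3 := by positivity
  -- bounds of the eight products on D
  have q1 : ∀ a ∈ D, |P1 a| ≤ (2 * B) ^ 3 := trip bC₁ bC₂ bCu
  have q2 : ∀ a ∈ D, |P2 a| ≤ (2 * B) ^ 3 := trip bC₁ bC₂ (b2 bUo)
  have q3 : ∀ a ∈ D, |P3 a| ≤ (2 * B) ^ 3 := trip bC₁ (b2 bO₂) bCu
  have q4 : ∀ a ∈ D, |P4 a| ≤ (2 * B) ^ 3 := trip bC₁ (b2 bO₂) (b2 bUo)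
  have q5 : ∀ a ∈ D, |P5 a| ≤ (2 * B) ^ 3 := trip (b2 bO₁) bC₂ bCu
  have q6 : ∀ a ∈ D, |P6 a| ≤ (2 * B) ^ 3 := trip (b2 bO₁) bC₂ (b2 bUo)
  have q7 : ∀ a ∈ D, |P7 a| ≤ (2 * B) ^ 3 := trip (b2 bO₁) (b2 bO₂) bCu
  have q8 : ∀ a ∈ D, |P8 a| ≤ (2 * B) ^ 3 := trip (b2 bO₁) (b2 bO₂) (b2 bUo)
  -- measurability of the eight products
  have n1 : Measurable P1 := (mC₁.mul mC₂).mul mCu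
  have n2 : Measurable P2 := (mC₁.mul mC₂).mul mUo
  have n3 : Measurable P3 := (mC₁.mul mO₂).mul mCu
  have n4 : Measurable P4 := (mC₁.mul mO₂).mul mUo
  have n5 : Measurable P5 := (mO₁.mul mC₂).mul mCu
  have n6 : Measurable P6 := (mO₁.mul mC₂).mul mUo
  have n7 : Measurable P7 := (mO₁.mul mO₂).mul mCu
  have n8 : Measurable P8 := (mO₁.mul mO₂).mul mUo
  -- pairwise sums
  have add2 : ∀ {F G : (LandauFree H → E3) → ℝ} {C : ℝ}, (∀ a ∈ D, |F a| ≤ C) → (∀ a ∈ D, |G a| ≤ C) →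
      ∀ a ∈ D, |F a + G a| ≤ 2 * C := fun hF hG a ha => (abs_add_le _ _).trans (by linarith [hF a ha, hG a ha])
  have q12 : ∀ a ∈ D, |P1 a + P2 a| ≤ 2 * (2 * B) ^ 3 := add2 q1 q2
  have q34 : ∀ a ∈ D, |P3 a + P4 a| ≤ 2 * (2 * B) ^ 3 := add2 q3 q4
  have q56 : ∀ a ∈ D, |P5 a + P6 a| ≤ 2 * (2 * B) ^ 3 := add2 q5 q6
  have q78 : ∀ a ∈ D, |P7 a + P8 a| ≤ 2 * (2 * B) ^ 3 := add2 q7 q8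
  have q1234 : ∀ a ∈ D, |(P1 a + P2 a) + (P3 a + P4 a)| ≤ 2 * (2 * (2 * B) ^ 3) := add2 q12 q34
  have q5678 : ∀ a ∈ D, |(P5 a + P6 a) + (P7 a + P8 a)| ≤ 2 * (2 * (2 * B) ^ 3) := add2 q56 q78
  have n12 : Measurable fun a => P1 a + P2 a := n1.add n2
  have n34 : Measurable fun a => P3 a + P4 a := n3.add n4
  have n56 : Measurable fun a => P5 a + P6 a := n5.add n6
  have n78 : Measurable fun a => P7 a + P8 a := n7.add n8
  have n1234 : Measurable fun a => (P1 a + P2 a) + (P3 a + P4 a) := n12.add n34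
  have n5678 : Measurable fun a => (P5 a + P6 a) + (P7 a + P8 a) := n56.add n78
  have s12 := tiltExp_muSet_zero_add hβ hDm U hB8 n1 n2 q1 q2
  have s34 := tiltExp_muSet_zero_add hβ hDm U hB8 n3 n4 q3 q4
  have s56 := tiltExp_muSet_zero_add hβ hDm U hB8 n5 n6 q5 q6
  have s78 := tiltExp_muSet_zero_add hβ hDm U hB8 n7 n8 q7 q8
  have s1234 := tiltExp_muSet_zero_add hβ hDm U (by positivity : (0:ℝ) ≤ 2 * (2 * B) ^ 3) n12 n34 q12 q34
  have s5678 := tiltExp_muSet_zero_add hβ hDm U (by positivity : (0:ℝ) ≤ 2 * (2 * B) ^ 3) n56 n78 q56 q78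
  have sAll := tiltExp_muSet_zero_add hβ hDm U (by positivity : (0:ℝ) ≤ 2 * (2 * (2 * B) ^ 3)) n1234 n5678 q1234 q5678
  -- the cumulant's integrand equals the sum of the eight products
  have hint : (fun a => ((fun a => E₁ a + O₁ a) a - Tilt.tiltExp μD U 0 (fun a => E₁ a + O₁ a)) *
      ((fun a => E₂ a + O₂ a) a - Tilt.tiltExp μD U 0 (fun a => E₂ a + O₂ a)) * (U a - Tilt.tiltExp μD U 0 U)) =
      fun a => ((P1 a + P2 a) + (P3 a + P4 a)) + ((P5 a + P6 a) + (P7 a + P8 a)) := by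
    funext a
    simp only [hG₁, hG₂, hU, U, hP1, hP2, hP3, hP4, hP5, hP6, hP7, hP8]
    ring
  show Tilt.tiltExp μD U 0 _ = _
  rw [hint, sAll, s1234, s5678, s12, s34, s56, s78, v2, v3, v5, v8]
  ring

end GaussRestrict

end Summit.QuantumFields.YangMills.Theorems.AllWindowsColdBoxBoxHighLine

end
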